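import Summits.HubbardSuperconductivity.HubbardSuperconductivity.Theorems.AnisotropyChordTransferFibre3RowCXSCells
import Summits.HubbardSuperconductivity.HubbardSuperconductivity.Theorems.AnisotropyChordTransferFibre3N1RowL2N09939

/-!
# Route `AnisotropyChord` / H0 rotor rung, LEVEL 2 row C (KT-2b): the `ν`-column `[9939, 10734]/10⁶` — the X-sum bracket

The `ν`-cell `ν = λ₂/θ² ∈ [0.009939, 0.010734]` (p2's column `colN09939`): the L-uniform bracket of the positive Parseval sum of the
phase-defect moment, ★ `xsN09939` : `RowC.xsCellCheck 128 … (450/100) = true` — for every `L ≥ 128` and every `ν` in the column,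
`XSn(L, νθ²) ≤ 450/100` (window `K = 32` pointwise majorants + tail by the column's certified totals `θ⁴S₂ ≤ 6154810661/1000000000`,
`θ⁴T10 ≤ 3782778241/1000000000`; `RowC.xs_cell_sound`; exact-ℚ mirror value 4.4778); one kernel `decide` (≈ 75 s); shared by all `a`-cells
of this column (files `…RowCL2N09939A….lean`).
Prover seat `hubbard-h0-rotor-p1` g28 (route lead); helper for piece A = stmt-HubbardSuperconductivity-23918 of rung 19089
(`--supports`, helper class).  Nothing here proves superconductivity in the Hubbard model; one kernel-certified piece of ONE
conditional reduction (the GM₃ ∀L certificate, Level-2 row C = KT-2b); the rotor TARGET as originally worded stays FALSE (g15 verdict).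
Mathlib + the tree only; no sorry.  Generated by p1 g28's rowc/mkfiles.py (HOME/hubbard-h0-rotor-p1/rowc/).
-/

set_option linter.dupNamespace false
set_option autoImplicit false

open Literature.Analysis.ValidatedNumerics

namespace Summit.HubbardSuperconductivity.HubbardSuperconductivity.Theorems.AnisotropyChord.Transfer.Fibre3.L2.KT2b

open L2.N1

/-- ★ the X-sum bracket of the column `colN09939`: `XSn ≤ 450/100` for all `L ≥ 128`, `ν ∈ [9939, 10734]/10⁶` (kernel evaluation of `RowC.xsCellCheck`). -/
theorem xsN09939 :
    RowC.xsCellCheck 128 colN09939.n1 colN09939.n2 colN09939.νd colN09939.Tn colN09939.Td 1000000 colN09939.bS2.2 colN09939.bT10.2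
      ((450 : ℚ) / 100) = true := by
  decide +kernel

end Summit.HubbardSuperconductivity.HubbardSuperconductivity.Theorems.AnisotropyChord.Transfer.Fibre3.L2.KT2b
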